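import Mathlib
import Summits.QuantumFields.YangMills.Theorems.CoarseStiffnessTailCappedCoarseStiffnessLUnitPolyTail

/-!
# Route `CoarseStiffnessTail` — THE RATE-FREE TOP-SLICE SUPPLIER, file 2 of 2: the registered EDGE stub, its logarithmic form and the crux
# all imply the power-law unit-scale tail S1_poly (lead's certificate, seat `ym-line-cst-p1` g22; helper on crux stmt-QuantumFields-25301)

Continuation of `CoarseStiffnessTailCappedCoarseStiffnessLUnitPolyTail` (S1_poly ⇒ `UnitScaleTilt.HistoryTailL` 19936 and ⇒ `HistoryWedge.WedgeTailL`
27959 by name; the deciding theorem with S1_poly).  Notation as there: `P_top(F, γ, K, a) = Gibbs_K{θ_γ(0) ≤ |Ū^{K}(∂a) − 1|}`,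
`N_K = #{a : θ_γ(0) ≤ |Ū^{K}(∂a) − 1|}`, `p = B10.pFun b₀ p₀`,

  S1_poly := `∀ L b₁ p₁ ∃ b₀ ≥ b₁, p₀ ≥ p₁ (0 < b₀, 2 < p₀) ∃ s > 3, C ≥ 0, γ₁ ∈ (0,1] ∀ F (F.L = L) ∀ γ ∈ (0, γ₁] ∀ K a: P_top ≤ C·γ^s`,
  S1_log  := `∀ L b₀ p₀ ∃ c₀ C₀ γ₁ A ∀ F γ K: ∫ exp(c₀·p(√γ)²·N_K) dGibbs_K ≤ exp((C₀ + A·log γ⁻¹)·#Plaq_K)`   (g21),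
  S1_top  := S1_log with `A = 0` = the registered EDGE stub `stub_unitLargeFieldCount` of skeleton v9   (g20).

* §1 `perPlaquetteTop_of_countTop` — CHESSBOARD AT THE TOP SLICE for every cut-off `K ≥ 0`, any threshold and rate: a count exponential moment
  `∫ e^{t·N} dGibbs_K ≤ e^{C₁·#Plaq_K}` gives the single-plaquette tail `e^{9000L³|C₁|}·e^{−t}` (`chessboardRP_T3` at `ρ = 1`, `jointPeierls_of_count`,
  `#Plaq_K ≤ 9000L³|S|`; the all-`K` top-slice form of g5's `perPlaquette_of_largeFieldCount`).
* §2 `exp_neg_pFun_sq_le_pow` — «THE GAUSSIAN LARGE-FIELD FACTOR IS BELOW EVERY POWER OF THE COUPLING»: for `0 < b₀`, `2 ≤ p₀`, `0 < c`, `N : ℕ`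
  there is `γ₀ ∈ (0,1]` with `e^{−c·p(√γ)²} ≤ γ^N` on `(0, γ₀]` (`p(√γ)² ≥ b₀²(log γ⁻¹)⁴/16`).
* §3 ★★ `unitPolyTail_of_unitLargeFieldCountLog` : S1_log ⇒ S1_poly (`s = 4`, `C = e^{9000L³|C₀|}`, profile `(max b₁ 1, max p₁ 3)`);
  `unitPolyTail_of_unitLargeFieldCount` : THE REGISTERED EDGE STUB S1_top ⇒ S1_poly; `unitPolyTail_of_cappedCoarseStiffnessL` : THE CRUX 25301 ⇒ S1_poly.

Kernel partial order completed: `CappedCoarseStiffnessL (25301) ⇒ S1_top ⇒ S1_log ⇒ S1_poly ⇒ {HistoryTailL (19936), WedgeTailL (27959)}`.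
S1_poly is a FACTOR of the registered stub with strictly fewer demands: no joint event, no Gaussian rate `c₀·p(g)²`, no uniform `c₀`, profile
chosen beyond thresholds — a power `γ^s`, `s > 3`, of the coupling, uniform in `(K, m, γ ≤ γ₁)`.

HONEST SCOPE.  A chessboard step and one real-analysis inequality on top of landed certificates; NO Gibbs integral is estimated; S1_poly, S1_log,
S1_top, the crux 25301, `HistoryTailL` 19936, `WedgeTailL` 27959 and every rung above stay OPEN ([Balaban1985UV3] (71) p.273 at the last
renormalisation steps, integrated against the Gibbs law, uniformly in the cut-off); `YM3TorusSU2` (rung R3, a RECORD rung, not the Clay statement)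
is NOT proved; the Yang–Mills mass gap is NOT touched.

References: J. Fröhlich, R. Israel, E. Lieb, B. Simon, CMP **62** (1978) 1–34 [FrohlichIsraelLiebSimon1978] (Thm 4.1: chessboard); T. Bałaban,
CMP **102** (1985) 255–275 [Balaban1985UV3] ((7) p.257: `p(g) = b₀(1 + log g⁻¹)^{p₀}`; (71) p.273).
-/

noncomputable section

namespace Summit.QuantumFields.YangMills.Theorems.CoarseStiffnessTailUnitPolyTailOfCount

open MeasureTheory Finset
open Literature.MathematicalPhysics.QuantumFieldTheory
open Literature.MathematicalPhysics.QuantumFieldTheory.Balaban1983to89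
open Literature.MathematicalPhysics.QuantumFieldTheory.Balaban1983to89.T3ContinuumYM3Torus
open Literature.MathematicalPhysics.QuantumFieldTheory.Balaban1983to89.T3UnitScaleTilt
open Literature.MathematicalPhysics.QuantumFieldTheory.Balaban1983to89.T3UnitLawDensityEML
open Summit.QuantumFields.YangMills.Theorems.HistoryTailChessboardT3 (chessboardRP_T3)
open Summit.QuantumFields.YangMills.Theorems.CoarseStiffnessTailHistoryTailOfStiffness (card_plaq_le_of_chessboard)
open Summit.QuantumFields.YangMills.Theorems.CoarseStiffnessTailLargeFieldCount (jointPeierls_of_count)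
open Summit.QuantumFields.YangMills.Theorems.CoarseStiffnessTailUnitCountLogSlack
  (unitLargeFieldCountLog_of_unitLargeFieldCount unitLargeFieldCountLog_of_cappedCoarseStiffnessL)

/-! ## §1–§3 The registered EDGE stub, its logarithmic form and the crux all imply S1_poly -/

section Chessboard

variable (F : T3Family)

/-- **CHESSBOARD AT THE TOP SLICE** (one family, `0 < γ ≤ 1`, ANY cut-off `K ≥ 0`, any threshold `θ`, any rate `t ≥ 0`): if the unit-lattice
count `N = #{a : θ ≤ |Ū^{K}(∂a) − 1|}` has `∫ e^{t·N} dGibbs_K ≤ e^{C₁·#Plaq_K}`, then EVERY unit plaquette has tail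
`Gibbs_K{θ ≤ |Ū^{K}(∂a) − 1|} ≤ e^{9000L³|C₁|}·e^{−t}`: the chessboard `chessboardRP_T3` (`ρ = 1`) bounds the single event by the `1/|S|`-th root of
the joint event of its chessboard family `S`, `jointPeierls_of_count` bounds the joint event by `e^{−t|S|}·e^{C₁#Plaq_K}`, and `#Plaq_K ≤ 9000L³|S|`.
(The top-slice case, all `K`, of g5's `perPlaquette_of_largeFieldCount`.) [cite: FrohlichIsraelLiebSimon1978, Thm 4.1] -/
theorem perPlaquetteTop_of_countTop {γ θ t C₁ : ℝ} (hγ : 0 < γ) (hγ1 : γ ≤ 1) (ht : 0 ≤ t) (K : ℕ)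
    (hN : ∫ U, Real.exp (t * ∑ a : Plaq (F.P K) K, (if θ ≤ GaugeGroup.dist1 (GaugeField.plaqHol
        (Averaging.iter (fun i => BlockAveraging.blockAvg (P := F.P K) (j := i) ℰp) K U) a) then (1 : ℝ) else 0))
        ∂(gibbsK F ℰp γ K) ≤ Real.exp (C₁ * (Fintype.card (Plaq (F.P K) K) : ℝ)))
    (a : Plaq (F.P K) K) :
    (gibbsK F ℰp γ K).real {U | θ ≤ GaugeGroup.dist1 (GaugeField.plaqHol
        (Averaging.iter (fun i => BlockAveraging.blockAvg (P := F.P K) (j := i) ℰp) K U) a)} ≤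
      Real.exp (9000 * (F.L : ℝ) ^ 3 * |C₁|) * Real.exp (-t) := by
  haveI := isProbabilityMeasure_gibbsK F ℰp hγ.le K
  have hL1 : 1 < F.L := F.hL.2
  -- the chessboard family at separation `ρ = 1`
  obtain ⟨S, hpS, -, hcount, hchess⟩ :=
    chessboardRP_T3 F.L F.hL.1 hL1 F γ rfl hγ hγ1 θ K K le_rfl 1 le_rfl a
  have hS0 : 0 < S.card := Finset.card_pos.mpr ⟨a, hpS⟩
  have hS0R : (0 : ℝ) < (S.card : ℝ) := by exact_mod_cast hS0
  -- joint Peierls for the family `S` at rate `t`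
  have hjoint : (gibbsK F ℰp γ K).real {U | ∀ q ∈ S, θ ≤ GaugeGroup.dist1 (GaugeField.plaqHol
        (Averaging.iter (fun _ => BlockAveraging.blockAvg ℰp) K U) q)} ≤
      Real.exp (-t * (S.card : ℝ)) * Real.exp (C₁ * (Fintype.card (Plaq (F.P K) K) : ℝ)) :=
    jointPeierls_of_count F hγ.le K K θ ht hN S
  -- take the `1/|S|`-th power
  have hbase0 : 0 ≤ (gibbsK F ℰp γ K).real {U | ∀ q ∈ S, θ ≤ GaugeGroup.dist1 (GaugeField.plaqHol
        (Averaging.iter (fun _ => BlockAveraging.blockAvg ℰp) K U) q)} := measureReal_nonneg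
  have hexpS : 0 ≤ (1 : ℝ) / (S.card : ℝ) := by positivity
  have hpow := Real.rpow_le_rpow hbase0 hjoint hexpS
  have hrhs : (Real.exp (-t * (S.card : ℝ)) * Real.exp (C₁ * (Fintype.card (Plaq (F.P K) K) : ℝ))) ^
        ((1 : ℝ) / (S.card : ℝ)) =
      Real.exp (-t + C₁ * (Fintype.card (Plaq (F.P K) K) : ℝ) / (S.card : ℝ)) := by
    rw [← Real.exp_add, ← Real.exp_mul]
    congr 1
    field_simp
  rw [hrhs] at hpow
  refine (hchess.trans hpow).trans ?_
  -- the constants: `C₁ #Plaq_K / |S| ≤ 9000 L³ |C₁|`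
  have hcard : (Fintype.card (Plaq (F.P K) K) : ℝ) ≤ 9000 * (F.L : ℝ) ^ 3 * (S.card : ℝ) :=
    card_plaq_le_of_chessboard F K K hcount
  have hC : C₁ * (Fintype.card (Plaq (F.P K) K) : ℝ) / (S.card : ℝ) ≤ 9000 * (F.L : ℝ) ^ 3 * |C₁| := by
    rw [div_le_iff₀ hS0R]
    have h1 : C₁ * (Fintype.card (Plaq (F.P K) K) : ℝ) ≤ |C₁| * (Fintype.card (Plaq (F.P K) K) : ℝ) :=
      mul_le_mul_of_nonneg_right (le_abs_self C₁) (Nat.cast_nonneg _)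
    have h2 : |C₁| * (Fintype.card (Plaq (F.P K) K) : ℝ) ≤ |C₁| * (9000 * (F.L : ℝ) ^ 3 * (S.card : ℝ)) :=
      mul_le_mul_of_nonneg_left hcard (abs_nonneg _)
    nlinarith
  rw [mul_comm (Real.exp (9000 * (F.L : ℝ) ^ 3 * |C₁|)), ← Real.exp_add]
  exact Real.exp_le_exp.mpr (by linarith)

end Chessboard

section Rate

/-- **THE GAUSSIAN LARGE-FIELD FACTOR IS BELOW EVERY POWER OF THE COUPLING** (`0 < b₀`, `2 ≤ p₀`, `0 < c`, `N : ℕ`): there is `γ₀ ∈ (0, 1]`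
with `exp(−c·p(√γ)²) ≤ γ^N` for all `0 < γ ≤ γ₀`, where `p(g) = b₀(1 + log g⁻¹)^{p₀}` ([Balaban1985UV3] (7) p.257): with `u = log γ⁻¹`,
`p(√γ) = b₀(1 + u/2)^{p₀} ≥ b₀(u/2)²`, so `c·p(√γ)² ≥ c·b₀²u⁴/16 ≥ N·u` once `u ≥ max(1, 16N/(c·b₀²))`, and `e^{−Nu} = γ^N`.
[cite: Balaban1985UV3, (7) p.257] -/
theorem exp_neg_pFun_sq_le_pow {b₀ p₀ c : ℝ} (hb₀ : 0 < b₀) (hp₀ : 2 ≤ p₀) (hc : 0 < c) (N : ℕ) :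
    ∃ γ₀ : ℝ, 0 < γ₀ ∧ γ₀ ≤ 1 ∧ ∀ γ : ℝ, 0 < γ → γ ≤ γ₀ →
      Real.exp (-(c * B10.pFun b₀ p₀ (Real.sqrt γ) ^ 2)) ≤ γ ^ N := by
  set u₀ : ℝ := max 1 (16 * N / (c * b₀ ^ 2)) with hu₀def
  have hu₀1 : 1 ≤ u₀ := le_max_left _ _
  have hu₀N : 16 * N / (c * b₀ ^ 2) ≤ u₀ := le_max_right _ _
  refine ⟨Real.exp (-u₀), Real.exp_pos _, by rw [Real.exp_le_one_iff]; linarith, fun γ hγ hγle => ?_⟩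
  -- `u = log γ⁻¹ ≥ u₀`
  set u : ℝ := Real.log γ⁻¹ with hudef
  have hu : u₀ ≤ u := by
    have h1 : Real.log γ ≤ Real.log (Real.exp (-u₀)) := Real.log_le_log hγ hγle
    rw [Real.log_exp] at h1
    rw [hudef, Real.log_inv]
    linarith
  have hu1 : 1 ≤ u := hu₀1.trans hu
  have hu0 : 0 ≤ u := zero_le_one.trans hu1
  -- `p(√γ) ≥ b₀ (u/2)²`
  have hx : 1 + Real.log (Real.sqrt γ)⁻¹ = 1 + u / 2 := by
    rw [Real.log_inv, Real.log_sqrt hγ.le, hudef, Real.log_inv]; ring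
  have hx1 : (1 : ℝ) ≤ 1 + u / 2 := by linarith
  have hpow2 : (1 + u / 2) ^ (2 : ℕ) ≤ (1 + u / 2) ^ p₀ := by
    rw [← Real.rpow_natCast]
    exact Real.rpow_le_rpow_of_exponent_le hx1 (by exact_mod_cast hp₀)
  have hsq : (u / 2) ^ (2 : ℕ) ≤ (1 + u / 2) ^ (2 : ℕ) := by
    have : 0 ≤ u / 2 := by linarith
    nlinarith
  have hp : b₀ * (u / 2) ^ (2 : ℕ) ≤ B10.pFun b₀ p₀ (Real.sqrt γ) := by
    unfold B10.pFun
    rw [hx]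
    exact mul_le_mul_of_nonneg_left (hsq.trans hpow2) hb₀.le
  have hp0 : 0 ≤ b₀ * (u / 2) ^ (2 : ℕ) := by positivity
  have hpsq : (b₀ * (u / 2) ^ (2 : ℕ)) ^ 2 ≤ B10.pFun b₀ p₀ (Real.sqrt γ) ^ 2 := pow_le_pow_left₀ hp0 hp 2
  -- `c·b₀²u⁴/16 ≥ N·u`
  have hcb : 0 < c * b₀ ^ 2 := by positivity
  have hu3 : 16 * N / (c * b₀ ^ 2) ≤ u ^ 3 := by
    have h1 : u ≤ u ^ 3 := by nlinarith
    exact (hu₀N.trans hu).trans h1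
  have hNu : (N : ℝ) * u ≤ c * (b₀ * (u / 2) ^ (2 : ℕ)) ^ 2 := by
    rw [div_le_iff₀ hcb] at hu3
    have h1 : c * (b₀ * (u / 2) ^ (2 : ℕ)) ^ 2 = (c * b₀ ^ 2) * u ^ 3 * u / 16 := by ring
    rw [h1]
    have hN0 : (0 : ℝ) ≤ N := Nat.cast_nonneg _
    nlinarith
  -- conclude: `exp(−c·p²) ≤ exp(−N·u) = γ^N`
  have hγN : Real.exp (-((N : ℝ) * u)) = γ ^ N := by
    rw [hudef, Real.log_inv, mul_neg, neg_neg, Real.exp_nat_mul, Real.exp_log hγ]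
  rw [← hγN]
  exact Real.exp_le_exp.mpr (by nlinarith)

end Rate

section Log

/-- ★★ **S1_log ⇒ S1_poly** (with `s = 4`, profile `(max b₁ 1, max p₁ 3)`, `C = e^{9000L³|C₀|}`): at the top slice the count bound with
logarithmic slack gives, by the chessboard (`perPlaquetteTop_of_countTop` with `t = c₀·p(√γ)²`, `C₁ = C₀ + A·log γ⁻¹`), the single-plaquette tail
`≤ e^{9000L³|C₀|}·γ^{−9000L³A}·e^{−c₀·p(√γ)²}`, and the Gaussian factor is below `γ^{9000L³A + 4}` for `γ ≤ γ₀` (`exp_neg_pFun_sq_le_pow`).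
Conditional certificate; both sides OPEN. [cite: Balaban1985UV3, (7) p.257 and (71) p.273; FrohlichIsraelLiebSimon1978, Thm 4.1] -/
theorem unitPolyTail_of_unitLargeFieldCountLog
    (h : ∀ (L : ℕ) (b₀ p₀ : ℝ), 0 < b₀ → 2 < p₀ → ∃ (c₀ C₀ γ₁ : ℝ) (A : ℕ), 0 < c₀ ∧ 0 < γ₁ ∧ γ₁ ≤ 1 ∧
      ∀ (F : T3Family) (γ : ℝ), F.L = L → 0 < γ → γ ≤ γ₁ → ∀ (K : ℕ),
        ∫ U, Real.exp (c₀ * B10.pFun b₀ p₀ (Real.sqrt γ) ^ 2 *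
            ∑ a : Plaq (F.P K) K, (if T3UnitScaleTilt.θBal F.L γ b₀ p₀ 0 ≤ GaugeGroup.dist1 (GaugeField.plaqHol
              (Averaging.iter (fun i => BlockAveraging.blockAvg (P := F.P K) (j := i) T3UnitLawDensityEML.ℰp) K U) a)
              then (1 : ℝ) else 0)) ∂(T3UnitScaleTilt.gibbsK F T3UnitLawDensityEML.ℰp γ K) ≤
          Real.exp ((C₀ + A * Real.log γ⁻¹) * (Fintype.card (Plaq (F.P K) K) : ℝ))) :
    ∀ (L : ℕ) (b₁ p₁ : ℝ), ∃ (b₀ p₀ : ℝ), b₁ ≤ b₀ ∧ p₁ ≤ p₀ ∧ 0 < b₀ ∧ 2 < p₀ ∧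
      ∃ (s C γ₁ : ℝ), 3 < s ∧ 0 ≤ C ∧ 0 < γ₁ ∧ γ₁ ≤ 1 ∧
        ∀ (F : T3Family) (γ : ℝ), F.L = L → 0 < γ → γ ≤ γ₁ → ∀ (K : ℕ) (a : Plaq (F.P K) K),
          (T3UnitScaleTilt.gibbsK F T3UnitLawDensityEML.ℰp γ K).real
              {U | T3UnitScaleTilt.θBal F.L γ b₀ p₀ 0 ≤ GaugeGroup.dist1 (GaugeField.plaqHol
                (Averaging.iter (fun i => BlockAveraging.blockAvg (P := F.P K) (j := i) T3UnitLawDensityEML.ℰp) K U) a)} ≤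
            C * γ ^ s := by
  intro L b₁ p₁
  have hb₀ : 0 < max b₁ 1 := lt_of_lt_of_le one_pos (le_max_right _ _)
  have hp₀ : 2 < max p₁ 3 := lt_of_lt_of_le (by norm_num) (le_max_right _ _)
  have hp₀2 : (2 : ℝ) ≤ max p₁ 3 := hp₀.le
  obtain ⟨c₀, C₀, γ₁, A, hc₀, hγ₁, hγ₁1, hTop⟩ := h L (max b₁ 1) (max p₁ 3) hb₀ hp₀
  obtain ⟨γ₀, hγ₀, -, hexp⟩ := exp_neg_pFun_sq_le_pow hb₀ hp₀2 hc₀ (9000 * L ^ 3 * A + 4)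
  refine ⟨max b₁ 1, max p₁ 3, le_max_left _ _, le_max_left _ _, hb₀, hp₀, ((4 : ℕ) : ℝ),
    Real.exp (9000 * (L : ℝ) ^ 3 * |C₀|), min γ₁ γ₀, by norm_num, (Real.exp_pos _).le, lt_min hγ₁ hγ₀,
    (min_le_left _ _).trans hγ₁1, fun F γ hFL hγ hγle K a => ?_⟩
  have hγγ₁ : γ ≤ γ₁ := hγle.trans (min_le_left _ _)
  have hγγ₀ : γ ≤ γ₀ := hγle.trans (min_le_right _ _)
  have hγ1 : γ ≤ 1 := hγγ₁.trans hγ₁1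
  have hN := hTop F γ hFL hγ hγγ₁ K
  subst hFL
  set t : ℝ := c₀ * B10.pFun (max b₁ 1) (max p₁ 3) (Real.sqrt γ) ^ 2 with htdef
  have ht : 0 ≤ t := mul_nonneg hc₀.le (sq_nonneg _)
  have htop := perPlaquetteTop_of_countTop F hγ hγ1 ht K hN a
  refine htop.trans ?_
  rw [Real.rpow_natCast]
  -- `|C₀ + A log γ⁻¹| ≤ |C₀| + A log γ⁻¹` and `exp(9000L³·A·log γ⁻¹) = (γ⁻¹)^{9000L³A}`
  have hlog : 0 ≤ Real.log γ⁻¹ := Real.log_nonneg ((one_le_inv₀ hγ).mpr hγ1)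
  have habs : |C₀ + A * Real.log γ⁻¹| ≤ |C₀| + A * Real.log γ⁻¹ := by
    refine (abs_add_le _ _).trans (le_of_eq ?_)
    rw [abs_of_nonneg (mul_nonneg (Nat.cast_nonneg _) hlog)]
  have hfac : Real.exp (9000 * (F.L : ℝ) ^ 3 * |C₀ + A * Real.log γ⁻¹|) ≤
      Real.exp (9000 * (F.L : ℝ) ^ 3 * |C₀|) * γ⁻¹ ^ (9000 * F.L ^ 3 * A) := by
    have hsplit : Real.exp (9000 * (F.L : ℝ) ^ 3 * (|C₀| + A * Real.log γ⁻¹)) =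
        Real.exp (9000 * (F.L : ℝ) ^ 3 * |C₀|) * γ⁻¹ ^ (9000 * F.L ^ 3 * A) := by
      rw [mul_add, Real.exp_add]
      congr 1
      rw [show 9000 * (F.L : ℝ) ^ 3 * (A * Real.log γ⁻¹) = ((9000 * F.L ^ 3 * A : ℕ) : ℝ) * Real.log γ⁻¹ by push_cast; ring,
        ← Real.log_pow, Real.exp_log (pow_pos (inv_pos.mpr hγ) _)]
    rw [← hsplit]
    exact Real.exp_le_exp.mpr (mul_le_mul_of_nonneg_left habs (by positivity))
  have hγpow : γ⁻¹ ^ (9000 * F.L ^ 3 * A) * γ ^ (9000 * F.L ^ 3 * A + 4) = γ ^ 4 := by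
    rw [pow_add, ← mul_assoc, inv_pow, inv_mul_cancel₀ (pow_ne_zero _ hγ.ne'), one_mul]
  calc Real.exp (9000 * (F.L : ℝ) ^ 3 * |C₀ + A * Real.log γ⁻¹|) * Real.exp (-t)
      ≤ (Real.exp (9000 * (F.L : ℝ) ^ 3 * |C₀|) * γ⁻¹ ^ (9000 * F.L ^ 3 * A)) * γ ^ (9000 * F.L ^ 3 * A + 4) :=
        mul_le_mul hfac (hexp γ hγ hγγ₀) (Real.exp_pos _).le (by positivity)
    _ = Real.exp (9000 * (F.L : ℝ) ^ 3 * |C₀|) * γ ^ 4 := by rw [mul_assoc, hγpow]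

/-- **THE REGISTERED EDGE STUB ⇒ S1_poly**: skeleton v9's `stub_unitLargeFieldCount` (S1_top, signature verbatim) is S1_log with `A = 0`
(g21's `unitLargeFieldCountLog_of_unitLargeFieldCount`).  Conditional certificate; both sides OPEN. [cite: Balaban1985UV3, (71) p.273] -/
theorem unitPolyTail_of_unitLargeFieldCount
    (h : ∀ (L : ℕ) (b₀ p₀ : ℝ), 0 < b₀ → 2 < p₀ → ∃ (c₀ C₀ γ₁ : ℝ), 0 < c₀ ∧ 0 < γ₁ ∧ γ₁ ≤ 1 ∧
      ∀ (F : T3Family) (γ : ℝ), F.L = L → 0 < γ → γ ≤ γ₁ → ∀ (K : ℕ),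
        ∫ U, Real.exp (c₀ * B10.pFun b₀ p₀ (Real.sqrt γ) ^ 2 *
            ∑ a : Plaq (F.P K) K, (if T3UnitScaleTilt.θBal F.L γ b₀ p₀ 0 ≤ GaugeGroup.dist1 (GaugeField.plaqHol
              (Averaging.iter (fun i => BlockAveraging.blockAvg (P := F.P K) (j := i) T3UnitLawDensityEML.ℰp) K U) a)
              then (1 : ℝ) else 0)) ∂(T3UnitScaleTilt.gibbsK F T3UnitLawDensityEML.ℰp γ K) ≤
          Real.exp (C₀ * (Fintype.card (Plaq (F.P K) K) : ℝ))) :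
    ∀ (L : ℕ) (b₁ p₁ : ℝ), ∃ (b₀ p₀ : ℝ), b₁ ≤ b₀ ∧ p₁ ≤ p₀ ∧ 0 < b₀ ∧ 2 < p₀ ∧
      ∃ (s C γ₁ : ℝ), 3 < s ∧ 0 ≤ C ∧ 0 < γ₁ ∧ γ₁ ≤ 1 ∧
        ∀ (F : T3Family) (γ : ℝ), F.L = L → 0 < γ → γ ≤ γ₁ → ∀ (K : ℕ) (a : Plaq (F.P K) K),
          (T3UnitScaleTilt.gibbsK F T3UnitLawDensityEML.ℰp γ K).real
              {U | T3UnitScaleTilt.θBal F.L γ b₀ p₀ 0 ≤ GaugeGroup.dist1 (GaugeField.plaqHol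
                (Averaging.iter (fun i => BlockAveraging.blockAvg (P := F.P K) (j := i) T3UnitLawDensityEML.ℰp) K U) a)} ≤
            C * γ ^ s :=
  unitPolyTail_of_unitLargeFieldCountLog (unitLargeFieldCountLog_of_unitLargeFieldCount h)

/-- **THE CRUX ⇒ S1_poly**: `CappedCoarseStiffnessL` (stmt-QuantumFields-25301) ⇒ S1_log (g21's `unitLargeFieldCountLog_of_cappedCoarseStiffnessL`,
through g20's `unitStubs_of_cappedCoarseStiffnessL`) ⇒ S1_poly.  S1_poly is a FACTOR of the crux with strictly fewer demands (no BULK conjunct, no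
joint event, no rate). [cite: Balaban1985UV3, (71) p.273] -/
theorem unitPolyTail_of_cappedCoarseStiffnessL
    (h : Summit.QuantumFields.YangMills.Theses.CoarseStiffnessTail.CappedCoarseStiffnessL) :
    ∀ (L : ℕ) (b₁ p₁ : ℝ), ∃ (b₀ p₀ : ℝ), b₁ ≤ b₀ ∧ p₁ ≤ p₀ ∧ 0 < b₀ ∧ 2 < p₀ ∧
      ∃ (s C γ₁ : ℝ), 3 < s ∧ 0 ≤ C ∧ 0 < γ₁ ∧ γ₁ ≤ 1 ∧
        ∀ (F : T3Family) (γ : ℝ), F.L = L → 0 < γ → γ ≤ γ₁ → ∀ (K : ℕ) (a : Plaq (F.P K) K),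
          (T3UnitScaleTilt.gibbsK F T3UnitLawDensityEML.ℰp γ K).real
              {U | T3UnitScaleTilt.θBal F.L γ b₀ p₀ 0 ≤ GaugeGroup.dist1 (GaugeField.plaqHol
                (Averaging.iter (fun i => BlockAveraging.blockAvg (P := F.P K) (j := i) T3UnitLawDensityEML.ℰp) K U) a)} ≤
            C * γ ^ s :=
  unitPolyTail_of_unitLargeFieldCountLog (unitLargeFieldCountLog_of_cappedCoarseStiffnessL h)

end Log

end Summit.QuantumFields.YangMills.Theorems.CoarseStiffnessTailUnitPolyTailOfCount

end
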